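import Mathlib

/-!
# `stub_accumulation` is FALSE without the normality of `Λ` (negative-side, crux `MuOrdinaryFamilyRT`)

Target: the registered stub `stub_accumulation` (Stub C) of the line
`Summits/Langlands/Langlands/Cruxes/MuOrdinaryFamilyRT/Lines/weight-blind-lambda-adic-rt.lean`
(crux item stmt-Langlands-13757).  Companion of `AccumulationDominance.lean`: here every
hypothesis of Stub C is kept verbatim — INCLUDING dominance — except that the instance
`[IsIntegrallyClosed Λ]` is deleted, and the statement becomes false
(`stub_accumulation_false_without_normality`).  So normality of the weight algebra is load-bearing
(it is what makes the minimal polynomial of a separating element integral, i.e. what makes fibre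
points move continuously with the weight).

Witness (the node).  `Λ = {g ∈ ℤ₃[X] : g(0) = g(1)}` (the equaliser of the two evaluations: a
Noetherian domain, finitely generated by `s = X² − X` and `X·s`, NOT normal since `X ∉ Λ` is
integral), `R = ℤ₃[X]` (finite over `Λ`: spanned by `1, X`), `x : X ↦ 0` (so `𝔮 = ⊥` dominates),
`D = {g ↦ g(1 + 3^{m+1})}` — weights converging uniformly to the node weight `g ↦ g(0) = g(1)`
(`‖g(1 + 3^{m+1}) − g(1)‖ ≤ 3^{-(m+1)}`), `E = ⊥`.  A point `y` of `R` over the weight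
`g ↦ g(c)`, `c = 1 + 3^{m+1}`, has `y(X)·c(c−1) = y(X·s) = c·c(c−1)`, hence `y(X) = c` exactly, at
distance `‖c − 0‖ = 1 > 3⁻¹` from `x(X) = 0`: accumulation fails at level `1`.
Sorry-free; imports Mathlib only.
-/

set_option linter.dupNamespace false -- project-wide option (lakefile weak.linter.dupNamespace); `Summit.Langlands.Langlands` is the mandated namespace

namespace Summit.Langlands.Langlands.Theorems.MuOrdinaryFamilyRT.Negative

open Polynomial

/-- The node subalgebra `{g : g(0) = g(1)} ⊆ ℤ₃[X]`, as the equaliser of the two evaluations.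
(Local abbreviation inside proofs only; stated here as a lemma about membership.) [folklore] -/
theorem mem_equalizer_aeval_zero_one (g : ℤ_[3][X]) :
    g ∈ AlgHom.equalizer (Polynomial.aeval (0 : ℤ_[3])) (Polynomial.aeval (1 : ℤ_[3])) ↔
      g.eval 0 = g.eval 1 := by
  rw [AlgHom.mem_equalizer, coe_aeval_eq_eval, coe_aeval_eq_eval]

/-- `X² − X` is monic of degree two. [folklore] -/
theorem monic_X_sq_sub_X : ((X : ℤ_[3][X]) ^ 2 - X).Monic :=
  (monic_X_pow 2).sub_of_left (by rw [degree_X_pow, degree_X]; norm_num)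

/-- A polynomial vanishing at `0` and `1` is a multiple of `X² − X`. [folklore] -/
theorem X_sq_sub_X_dvd_of_eval {p : ℤ_[3][X]} (h0 : p.eval 0 = 0) (h1 : p.eval 1 = 0) :
    (X : ℤ_[3][X]) ^ 2 - X ∣ p := by
  have hX : (X : ℤ_[3][X]) ∣ p := by
    rw [X_dvd_iff, coeff_zero_eq_eval_zero]; exact h0
  have hX1 : (X - C (1 : ℤ_[3])) ∣ p := by
    rw [dvd_iff_isRoot]; exact h1
  have hcop : IsCoprime (X : ℤ_[3][X]) (X - C 1) := ⟨1, -1, by simp⟩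
  have := hcop.mul_dvd hX hX1
  have e : (X : ℤ_[3][X]) * (X - C 1) = X ^ 2 - X := by simp [mul_sub, pow_two]
  rwa [e] at this

/-- The multiples `(X² − X)·X^n` lie in the subalgebra generated by `X² − X` and `X·(X² − X)`
(two-step induction on `n` using `X² = X + (X² − X)`). [folklore] -/
theorem X_sq_sub_X_mul_X_pow_mem_adjoin (n : ℕ) :
    ((X : ℤ_[3][X]) ^ 2 - X) * X ^ n ∈
      Algebra.adjoin ℤ_[3] ({(X : ℤ_[3][X]) ^ 2 - X, X * ((X : ℤ_[3][X]) ^ 2 - X)} :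
        Set ℤ_[3][X]) := by
  induction n using Nat.twoStepInduction with
  | zero =>
    rw [pow_zero, mul_one]
    exact Algebra.subset_adjoin (by simp)
  | one =>
    rw [pow_one, mul_comm]
    exact Algebra.subset_adjoin (by simp)
  | more n ih0 ih1 =>
    have e : ((X : ℤ_[3][X]) ^ 2 - X) * X ^ (n + 2) =
        ((X : ℤ_[3][X]) ^ 2 - X) * X ^ (n + 1) + ((X : ℤ_[3][X]) ^ 2 - X) * (((X : ℤ_[3][X]) ^ 2 - X) * X ^ n) := by
      ring
    rw [e]
    refine Subalgebra.add_mem _ ih1 (Subalgebra.mul_mem _ ?_ ih0)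
    exact Algebra.subset_adjoin (by simp)

/-- The node subalgebra is generated by `X² − X` and `X·(X² − X)`; in particular it is a finitely
generated `ℤ₃`-algebra. [folklore] -/
theorem equalizer_eq_adjoin :
    AlgHom.equalizer (Polynomial.aeval (0 : ℤ_[3])) (Polynomial.aeval (1 : ℤ_[3])) =
      Algebra.adjoin ℤ_[3] ({(X : ℤ_[3][X]) ^ 2 - X, X * ((X : ℤ_[3][X]) ^ 2 - X)} :
        Set ℤ_[3][X]) := by
  apply le_antisymm
  · intro g hg
    rw [mem_equalizer_aeval_zero_one] at hg
    -- g - C (g 0) vanishes at 0 and 1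
    have h0 : (g - C (g.eval 0)).eval 0 = 0 := by simp
    have h1 : (g - C (g.eval 0)).eval 1 = 0 := by simp [hg]
    obtain ⟨q, hq⟩ := X_sq_sub_X_dvd_of_eval h0 h1
    have eg : g = C (g.eval 0) + ((X : ℤ_[3][X]) ^ 2 - X) * q := by
      rw [← hq]; ring
    -- (X² - X) * q is in the adjoin for every q: linearity in q
    have key : ∀ q : ℤ_[3][X], ((X : ℤ_[3][X]) ^ 2 - X) * q ∈
        Algebra.adjoin ℤ_[3] ({(X : ℤ_[3][X]) ^ 2 - X, X * ((X : ℤ_[3][X]) ^ 2 - X)} :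
          Set ℤ_[3][X]) := by
      intro q
      induction q using Polynomial.induction_on' with
      | add p₁ p₂ hp₁ hp₂ =>
        rw [mul_add]
        exact Subalgebra.add_mem _ hp₁ hp₂
      | monomial n a =>
        rw [← C_mul_X_pow_eq_monomial, ← mul_assoc, mul_comm _ (C a), mul_assoc]
        exact Subalgebra.mul_mem _ (Subalgebra.algebraMap_mem _ a)
          (X_sq_sub_X_mul_X_pow_mem_adjoin n)
    rw [eg]
    exact Subalgebra.add_mem _ (Subalgebra.algebraMap_mem _ (g.eval 0)) (key q)
  · refine Algebra.adjoin_le ?_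
    rintro g (rfl | rfl) <;> simp

/-- **Stub C without normality is false (the node).**  The statement below is `stub_accumulation`
verbatim except that the instance hypothesis `[IsIntegrallyClosed Λ]` has been deleted.
[folklore] -/
theorem stub_accumulation_false_without_normality :
    ¬ ∀ (Λ R : Type) [CommRing Λ] [IsDomain Λ] [IsNoetherianRing Λ]
      [CommRing R] [Algebra Λ R] [Module.Finite Λ R]
      (x : R →+* PadicAlgCl 3) (D : Set (Λ →+* PadicAlgCl 3))
      (E : IntermediateField ℚ_[3] (PadicAlgCl 3)), FiniteDimensional ℚ_[3] E →
      (∃ 𝔮 : Ideal R, 𝔮.IsPrime ∧ Ideal.comap (algebraMap Λ R) 𝔮 = ⊥ ∧ ∀ r ∈ 𝔮, x r = 0) →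
      (∀ a : Λ, ‖x (algebraMap Λ R a)‖ ≤ 1) →
      (∀ κ ∈ D, ∀ a : Λ, κ a ∈ E ∧ ‖κ a‖ ≤ 1) →
      (∀ m : ℕ, ∃ κ ∈ D, ∀ a : Λ, ‖κ a - x (algebraMap Λ R a)‖ ≤ ((3 : ℝ)⁻¹) ^ m) →
    ∀ m : ℕ, ∃ y : R →+* PadicAlgCl 3, y.comp (algebraMap Λ R) ∈ D ∧
      ∀ r : R, ‖y r - x r‖ ≤ ((3 : ℝ)⁻¹) ^ m := by
  intro h
  classical
  -- the canonical embedding ι : ℤ₃ → ℚ₃ → ℚ̄₃ and its basic properties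
  set ι : ℤ_[3] →+* PadicAlgCl 3 :=
    RingHom.comp (algebraMap ℚ_[3] (PadicAlgCl 3)) PadicInt.Coe.ringHom with hι
  have hιnorm : ∀ z : ℤ_[3], ‖ι z‖ = ‖z‖ := fun z => by
    change ‖((z : ℚ_[3]) : PadicAlgCl 3)‖ = ‖z‖
    rw [PadicAlgCl.norm_extends, PadicInt.padic_norm_e_of_padicInt]
  have hιbot : ∀ z : ℤ_[3], ι z ∈ (⊥ : IntermediateField ℚ_[3] (PadicAlgCl 3)) := fun z =>
    IntermediateField.mem_bot.mpr ⟨(z : ℚ_[3]), rfl⟩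
  have h3 : ‖(3 : ℤ_[3])‖ = (3 : ℝ)⁻¹ := by
    have := PadicInt.norm_p (p := 3)
    simpa using this
  -- the node Λ = N ⊆ R = ℤ₃[X]
  set N : Subalgebra ℤ_[3] ℤ_[3][X] :=
    AlgHom.equalizer (Polynomial.aeval (0 : ℤ_[3])) (Polynomial.aeval (1 : ℤ_[3])) with hNdef
  have hN : ∀ g : ℤ_[3][X], g ∈ N ↔ g.eval 0 = g.eval 1 := mem_equalizer_aeval_zero_one
  set s : ℤ_[3][X] := X ^ 2 - X with hs
  have hsN : s ∈ N := by rw [hN]; simp [s]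
  have hXsN : X * s ∈ N := by rw [hN]; simp [s]
  haveI : IsNoetherianRing N := by
    haveI : Algebra.FiniteType ℤ_[3] N := by
      rw [← Subalgebra.fg_iff_finiteType]
      refine ⟨{(X : ℤ_[3][X]) ^ 2 - X, X * ((X : ℤ_[3][X]) ^ 2 - X)}, ?_⟩
      rw [Finset.coe_insert, Finset.coe_singleton, hNdef, equalizer_eq_adjoin]
    exact Algebra.FiniteType.isNoetherianRing ℤ_[3] N
  have halg : ∀ a : N, algebraMap N ℤ_[3][X] a = (a : ℤ_[3][X]) := fun a => rfl
  haveI : Module.Finite N ℤ_[3][X] := by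
    rw [Module.finite_def, Submodule.fg_def]
    refine ⟨{1, X}, (Set.finite_singleton X).insert 1, ?_⟩
    rw [eq_top_iff]
    rintro g -
    rw [Submodule.mem_span_pair]
    -- divide by the monic s = X² - X
    have hdiv := modByMonic_add_div g ((X : ℤ_[3][X]) ^ 2 - X)
    set r := g %ₘ ((X : ℤ_[3][X]) ^ 2 - X) with hr
    set q := g /ₘ ((X : ℤ_[3][X]) ^ 2 - X) with hq
    have hrdeg : r.degree ≤ 1 := by
      have := degree_modByMonic_lt g monic_X_sq_sub_X
      have hsdeg : ((X : ℤ_[3][X]) ^ 2 - X).degree = 2 := by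
        rw [degree_sub_eq_left_of_degree_lt] <;> simp
      rw [hsdeg] at this
      exact Order.le_of_lt_succ this
    have hr1 := eq_X_add_C_of_degree_le_one hrdeg
    have hm1 : s * q + C (r.coeff 0) ∈ N := by
      rw [hN]; simp [s]
    have hm2 : C (r.coeff 1) ∈ N := by rw [hN]; simp
    refine ⟨⟨_, hm1⟩, ⟨_, hm2⟩, ?_⟩
    change (s * q + C (r.coeff 0)) * 1 + C (r.coeff 1) * X = g
    have hr1' : C (r.coeff 1) * X + C (r.coeff 0) = r := hr1.symm
    calc (s * q + C (r.coeff 0)) * 1 + C (r.coeff 1) * X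
          = (C (r.coeff 1) * X + C (r.coeff 0)) + s * q := by ring
      _ = r + s * q := by rw [hr1']
      _ = g := by rw [hs]; exact hdiv
  -- the point x : X ↦ 0, the weights κ m : g ↦ g(1 + 3^(m+1)), the set D
  let x : ℤ_[3][X] →+* PadicAlgCl 3 := ι.comp (evalRingHom 0)
  let κ : ℕ → (N →+* PadicAlgCl 3) := fun m =>
    (ι.comp (evalRingHom (1 + (3 : ℤ_[3]) ^ (m + 1)))).comp (algebraMap N ℤ_[3][X])
  let D : Set (N →+* PadicAlgCl 3) := Set.range κ
  have hx : ∀ g : ℤ_[3][X], x g = ι (g.eval 0) := fun g => rfl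
  have hκ : ∀ m (a : N), κ m a = ι ((a : ℤ_[3][X]).eval (1 + (3 : ℤ_[3]) ^ (m + 1))) :=
    fun m a => rfl
  have hinj : Function.Injective (algebraMap N ℤ_[3][X]) := fun a b hab => Subtype.ext hab
  -- apply the would-be statement
  have H := h N ℤ_[3][X] x D ⊥ inferInstance
    ⟨⊥, Ideal.isPrime_bot, Ideal.comap_bot_of_injective _ hinj, fun r hr => by
      rw [Ideal.mem_bot] at hr; rw [hr, map_zero]⟩
    (fun a => by rw [halg, hx, hιnorm]; exact PadicInt.norm_le_one _)
    (by
      rintro κ' ⟨m, rfl⟩ a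
      exact ⟨by rw [hκ]; exact hιbot _, by rw [hκ, hιnorm]; exact PadicInt.norm_le_one _⟩)
    (by
      intro m
      refine ⟨κ m, ⟨m, rfl⟩, fun a => ?_⟩
      rw [hκ, halg, hx, ← map_sub, hιnorm]
      have ha : (a : ℤ_[3][X]).eval 0 = (a : ℤ_[3][X]).eval 1 := (hN a).mp a.2
      rw [ha]
      obtain ⟨w, hw⟩ := sub_dvd_eval_sub (1 + (3 : ℤ_[3]) ^ (m + 1)) 1 (a : ℤ_[3][X])
      rw [add_sub_cancel_left] at hw
      rw [hw, norm_mul, norm_pow, h3]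
      calc (3 : ℝ)⁻¹ ^ (m + 1) * ‖w‖ ≤ (3 : ℝ)⁻¹ ^ (m + 1) * 1 := by
            gcongr; exact PadicInt.norm_le_one w
        _ ≤ (3 : ℝ)⁻¹ ^ m := by
            rw [mul_one]
            exact pow_le_pow_of_le_one (by norm_num) (by norm_num) (Nat.le_succ m))
    1
  obtain ⟨y, ⟨m, hm⟩, hy⟩ := H
  set c : ℤ_[3] := 1 + (3 : ℤ_[3]) ^ (m + 1) with hc
  -- ‖c‖ = 1 and c² - c = c · 3^(m+1) ≠ 0
  have hcn : ‖(c : ℤ_[3])‖ = 1 := by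
    apply le_antisymm (PadicInt.norm_le_one c)
    have h31 : ‖(3 : ℤ_[3]) ^ (m + 1)‖ < 1 := by
      rw [norm_pow, h3]; exact pow_lt_one₀ (by norm_num) (by norm_num) (by omega)
    have := PadicInt.nonarchimedean (c : ℤ_[3]) (-(3 : ℤ_[3]) ^ (m + 1))
    rw [show c + -(3 : ℤ_[3]) ^ (m + 1) = 1 by rw [hc]; ring, norm_one, norm_neg] at this
    rcases le_max_iff.mp this with h | h
    · exact h
    · exact absurd h (not_le.mpr h31)
  have hcc : c ^ 2 - c ≠ 0 := by
    have e : c ^ 2 - c = c * (3 : ℤ_[3]) ^ (m + 1) := by rw [hc]; ring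
    rw [e]
    refine mul_ne_zero ?_ (pow_ne_zero _ (by norm_num))
    intro h0
    rw [h0, norm_zero] at hcn
    exact zero_ne_one hcn
  have hιne : ι (c ^ 2 - c) ≠ 0 := by
    intro h0
    have : ‖c ^ 2 - c‖ = 0 := by rw [← hιnorm, h0, norm_zero]
    exact hcc (norm_eq_zero.mp this)
  -- evaluate the weight identity at s and X * s
  have hys : y s = ι (c ^ 2 - c) := by
    have := congrArg (fun φ : N →+* PadicAlgCl 3 => φ ⟨s, hsN⟩) hm
    simp only [RingHom.coe_comp, Function.comp_apply] at this
    rw [hκ, ← hc, halg] at this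
    change ι (eval c s) = y s at this
    rw [← this]
    simp [s]
  have hyXs : y (X * s) = ι (c * (c ^ 2 - c)) := by
    have := congrArg (fun φ : N →+* PadicAlgCl 3 => φ ⟨X * s, hXsN⟩) hm
    simp only [RingHom.coe_comp, Function.comp_apply] at this
    rw [hκ, ← hc, halg] at this
    change ι (eval c (X * s)) = y (X * s) at this
    rw [← this]
    simp [s]
  have hyX : y X = ι c := by
    have e1 : y (X * s) = y X * y s := map_mul y X s
    rw [hyXs, hys, map_mul ι c] at e1
    exact (mul_right_cancel₀ hιne e1).symm
  -- distance of y X = c from x X = 0 is ‖c‖ = 1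
  have := hy X
  rw [hyX, hx, eval_X, map_zero, sub_zero, hιnorm, hcn, pow_one] at this
  norm_num at this

end Summit.Langlands.Langlands.Theorems.MuOrdinaryFamilyRT.Negative
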